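import Summits.ResolutionOfSingularities.ResolutionOfSingularities.Theorems.WildConesCampaignW46HypersurfacesCharTwoSatelliteExists

/-!
# [OURS · L1 W4.6, rung (ii) at p = 2, EVERY dimension n] `h₂` READ OFF THE NULL POLARS: at corank two,
# `h₂ = 1 + dim N`, where `N ⊆ ker P` is the space of kernel vectors whose polar of the tangent cubic
# vanishes identically on the kernel plane — `z² = a(u₁,…,uₙ)` over every field of characteristic 2

HONEST FRAMING. Everything here is OURS: theorems about route WildCones' own TYPED point-blow-up dynamics
(`Theorems/WildConesClassicalRegimesDefs.lean`) and the seat's invariants `polarMatrix` (p502936),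
`milnorEmbDim` (p498937), `milnorHilbertTwo` (p511581), `degForm` (p522667). NOTHING here is a statement
of the manuscript [Hironaka2017]; no FACT-LIST premise; AI review is weaker than expert review. Cell
res-hironaka (LADDER-RESOLUTION rung L, D-0089), slot W4.6, seat res-L1-s46-pv-4 (gen 6); host route
`WildCones`, crux `ClassicalRegimes` (stmt-ResolutionOfSingularities-16884; proved).

THE OBJECTS. `c` a double state (`MultP`) of `z² = a(u₁,…,uₙ)`, `a = ser c` cleaned, `P` its polar
matrix, corank `e(c) = 2` (kernel plane `K = ker P`). For `λ, v ∈ K` the POLAR is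
`polar(λ, v) = Σₛ λₛ · degForm 2 (∂ₛ a) v` (`= (D_λ a)₂(v)`, the polar of the tangent cubic `a₃|_K`;
linear in `λ`, quadratic in `v`). A NULL POLAR is a `λ ∈ K` with `polar(λ, ·) ≡ 0` on `K`; they form a
subspace `N ≤ K`, `dim N ∈ {0, 1, 2}`. Gen 5 proved `h₂ = 3 ⟺ N = K` (p531822) and `h₂ ≥ 2 ⟹ N ≠ 0`
(p538084). THIS FILE proves the missing direction `N ≠ 0 ⟹ h₂ ≥ 2` and assembles the trichotomy
`h₂ = 1 ⟺ N = 0`, `h₂ = 2 ⟺ N is a line`, `h₂ = 3 ⟺ N = K` — i.e. **`h₂ = 1 + dim N`**: the Hilbert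
function of the Milnor algebra at degree two is the nullity of the polar pencil of the kernel cubic, plus
one. In the binary normal form `g = αs³ + βs²t + γst² + δt³` of `a₃|_K` (characteristic two:
`∂ₛg = αs² + γt²`, `∂ₜg = βs² + δt²`) this is `h₂ = 3 − rank [[α, γ], [β, δ]]`: rank 2 = three distinct
tangents (`D₄`), rank 1 = a multiple tangent (`g = ℓ₁²ℓ₂` or `ℓ₁³`), rank 0 = no tangent cubic.

THE ARGUMENT for `N ∋ λ₀ ≠ 0 ⟹ h₂ ≥ 2`. With the linear generators `x, y` of `𝔪` modulo `(∂a)+𝔪²`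
(p529758) the six classes `1, x, y, x², xy, y²` SPAN `Q₃ = κ⟦u⟧/((∂a)+𝔪³)` (dimension `h₂ + 3`), so
`h₂ + 3 = 6 − dim(relations)`. A relation has trivial linear part (p531822, Step 1) and its quadratic
part `q = g₃x² + g₄xy + g₅y²` lies in `(∂a)+𝔪³`, hence (p531822, Step 2) `q ≡ D_λ a + r` with `λ ∈ K`,
`r ∈ 𝔪(∂a)`; evaluating degree-two forms at kernel vectors `v` gives
`g₃X(v)² + g₄X(v)Y(v) + g₅Y(v)² = polar(λ, v)`. Complete `λ₀` to a basis `λ₀, μ` of `K` and write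
`λ = αλ₀ + βμ`: then `polar(λ, ·) = β·polar(μ, ·)` on `K`. Reading off at the kernel vectors with
`(X, Y) = (1,0), (0,1), (1,1)` (p531822) shows `(g₃, g₄, g₅) = β·(q₁, q₃ − q₁ − q₂, q₂)` with
`qᵢ = polar(μ, vᵢ)`: ALL relations lie on ONE line, `dim(relations) ≤ 1`, `h₂ + 3 ≥ 5`.

WHAT IS PROVED (every `n`, every field of characteristic `2`, corank `e(c) = 2`):

* `hypersurface_two_le_milnorHilbertTwo_of_null_polar` — a non-zero null polar forces `h₂ ≥ 2`;
* `hypersurface_milnorHilbertTwo_eq_one_iff_no_null_polar` — **`h₂ = 1 ⟺ N = 0`** (the polar pencil of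
  the kernel cubic is injective: three distinct tangents);
* `hypersurface_two_le_milnorHilbertTwo_iff_null_polar` — `h₂ ≥ 2 ⟺ N ≠ 0`;
* `hypersurface_two_null_polars_milnorHilbertTwo_eq_three`, `hypersurface_null_polar_unique` — two
  non-proportional null polars force `h₂ = 3`; at `h₂ ≤ 2` the null polars are pairwise proportional;
* `hypersurface_milnorHilbertTwo_eq_two_iff_null_polar_line` — **`h₂ = 2 ⟺ N is a line`** (a non-zero
  null polar exists and some kernel polar value is non-zero); with p531822's `h₂ = 3 ⟺ N = K` this is
  the census `h₂ = 1 + dim N`.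

References: [CasasAlvero2000] §3 (free/satellite points of plane curves: context only);
[GreuelPfister2026] (Milnor/Tjurina numbers in positive characteristic: context); [Hironaka2017] Th. 16.6
p.84 — role replaced only, under adjudication; nothing of it is used.
-/

noncomputable section

-- single-problem summit: the doubled namespace component `ResolutionOfSingularities` is forced
set_option linter.dupNamespace false

open scoped BigOperators Classical

open MvPowerSeries IsLocalRing

open Literature.AlgebraicGeometry.Resolution

namespace Summit.ResolutionOfSingularities.ResolutionOfSingularities.Theorems

namespace CampaignW46.HypersurfacesCharTwo

open WildCones WildCones.MuDropCharTwoOrdP ThreefoldsCharTwo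

variable {κ : Type} [Field κ] {n : ℕ}

/-! ## The polar is linear in its first argument -/

/-- [OURS · L1 W4.6] The polar `Σₛ λₛ (∂ₛf)₂(v)` is linear in `λ`:
`polar(aλ + bμ, v) = a·polar(λ, v) + b·polar(μ, v)`. [folklore] -/
theorem polar_add_smul (f : MvPowerSeries (Fin n) κ) (a b : κ) (lam μ v : Fin n → κ) :
    ∑ s, (a • lam + b • μ) s * degForm 2 (MvPowerSeries.pderiv s f) v =
      a * ∑ s, lam s * degForm 2 (MvPowerSeries.pderiv s f) v +
        b * ∑ s, μ s * degForm 2 (MvPowerSeries.pderiv s f) v := by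
  rw [Finset.mul_sum, Finset.mul_sum, ← Finset.sum_add_distrib]
  refine Finset.sum_congr rfl fun s _ => ?_
  simp only [Pi.add_apply, Pi.smul_apply, smul_eq_mul]
  ring

/-- [OURS · L1 W4.6] The polar of a multiple: `polar(rλ, v) = r·polar(λ, v)`. [folklore] -/
theorem polar_smul_left (f : MvPowerSeries (Fin n) κ) (r : κ) (lam v : Fin n → κ) :
    ∑ s, (r • lam) s * degForm 2 (MvPowerSeries.pderiv s f) v =
      r * ∑ s, lam s * degForm 2 (MvPowerSeries.pderiv s f) v := by
  rw [Finset.mul_sum]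
  refine Finset.sum_congr rfl fun s _ => ?_
  simp only [Pi.smul_apply, smul_eq_mul]
  ring

/-! ## A non-zero null polar forces `h₂ ≥ 2` -/

/-- [OURS · L1 W4.6 rung (ii) at `p = 2`, every dimension; NOT a statement of the manuscript] **A NON-ZERO
NULL POLAR FORCES `h₂ ≥ 2`.** Let `c` be a double state of `z² = a(u₁,…,uₙ)` (any field of characteristic
`2`) with `e(c) = 2`, and `λ₀ ≠ 0` a kernel vector of the polar form whose polar `v ↦ Σₛ λ₀ₛ (∂ₛa)₂(v)`
vanishes at every kernel vector. Then `h₂(c) ≥ 2`: all relations among the six spanning classes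
`1, x, y, x², xy, y²` of `κ⟦u⟧/((∂a)+𝔪³)` lie on one line (see the file header), so this space has
dimension `≥ 5 = h₂ + 3`. (Converse of p538084's `h₂ ≥ 2 ⇒` a null polar exists.) [folklore] -/
theorem hypersurface_two_le_milnorHilbertTwo_of_null_polar [CharP κ 2] (c : (Fin n → ℕ) → κ)
    (hM : MultP 2 n κ c) (he : milnorEmbDim 2 n κ c = 2) {lam₀ : Fin n → κ} (hlam₀0 : lam₀ ≠ 0)
    (hlam₀ : Matrix.vecMul lam₀ (polarMatrix (ser 2 n κ c)) = 0)
    (hnull : ∀ v : Fin n → κ, Matrix.vecMul v (polarMatrix (ser 2 n κ c)) = 0 →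
      ∑ s, lam₀ s * degForm 2 (MvPowerSeries.pderiv s (ser 2 n κ c)) v = 0) :
    2 ≤ milnorHilbertTwo 2 n κ c := by
  set f := ser 2 n κ c with hfdef
  have hord : 2 ≤ f.order := two_le_order_ser hM
  have hf' := ((FormalCoordChange.two_le_order_iff f).mp hord).2
  have h3 : jetTwoColength f = 3 := by
    have h := (milnorEmbDim_le_and_mod_two hM).2.2
    rw [← hfdef] at h
    rw [h, he]
  have hr := milnorHilbertTwo_range hM he
  set J := Ideal.span (Set.range fun s => MvPowerSeries.pderiv s f) with hJ
  set I3 := J ⊔ maximalIdeal (MvPowerSeries (Fin n) κ) ^ 3 with hI3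
  have hfr3 : Module.finrank κ (MvPowerSeries (Fin n) κ ⧸ I3) = milnorHilbertTwo 2 n κ c + 3 := hr.2.2
  haveI : Module.Finite κ (MvPowerSeries (Fin n) κ ⧸ I3) := Module.finite_of_finrank_pos (by omega)
  obtain ⟨a, b, hgen⟩ := exists_linear_pair_of_jetTwoColength_eq_three hf' h3
  set x : MvPowerSeries (Fin n) κ := ∑ s, C (a s) * X s with hx
  set y : MvPowerSeries (Fin n) κ := ∑ s, C (b s) * X s with hy
  have hxm : x ∈ maximalIdeal (MvPowerSeries (Fin n) κ) := sum_C_mul_X_mem_maximalIdeal a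
  have hym : y ∈ maximalIdeal (MvPowerSeries (Fin n) κ) := sum_C_mul_X_mem_maximalIdeal b
  have hx0 := Literature.RingTheory.MvPowerSeries.Jets.mem_maximalIdeal_iff_constantCoeff_eq_zero.mp hxm
  have hy0 := Literature.RingTheory.MvPowerSeries.Jets.mem_maximalIdeal_iff_constantCoeff_eq_zero.mp hym
  -- complete `λ₀` to a kernel basis `λ₀, μ`; the polar of `μ`
  obtain ⟨μ, hμ, hnot, -⟩ := exists_kernel_pair hM he hlam₀0 hlam₀
  set q : (Fin n → κ) → κ := fun v => ∑ s, μ s * degForm 2 (MvPowerSeries.pderiv s f) v with hq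
  -- three kernel vectors with prescribed coordinates `(X, Y) = (1,0), (0,1), (1,1)`
  obtain ⟨v₁, hv₁, hx₁, hy₁⟩ := exists_kernel_vec_degForm_one_eq hM he hgen 1 0
  obtain ⟨v₂, hv₂, hx₂, hy₂⟩ := exists_kernel_vec_degForm_one_eq hM he hgen 0 1
  obtain ⟨v₃, hv₃, hx₃, hy₃⟩ := exists_kernel_vec_degForm_one_eq hM he hgen 1 1
  -- the line all relations lie on
  set u₀ : Fin 6 → κ := ![0, 0, 0, q v₁, q v₃ - q v₁ - q v₂, q v₂] with hu₀
  -- the six classes and the linear map `κ⁶ → Q₃`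
  set v6 : Fin 6 → MvPowerSeries (Fin n) κ ⧸ I3 := ![Ideal.Quotient.mk I3 1, Ideal.Quotient.mk I3 x,
    Ideal.Quotient.mk I3 y, Ideal.Quotient.mk I3 (x ^ 2), Ideal.Quotient.mk I3 (x * y),
    Ideal.Quotient.mk I3 (y ^ 2)] with hv6
  set L := Fintype.linearCombination κ v6 with hL
  -- `L` is onto (the six classes span)
  have hrange : LinearMap.range L = ⊤ := by
    refine eq_top_iff.mpr ?_
    rw [hL, Fintype.range_linearCombination]
    exact top_le_span_six hxm hym hgen
  -- every relation lies on the line through `u₀`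
  have hker : LinearMap.ker L ≤ κ ∙ u₀ := by
    intro g hg
    rw [LinearMap.mem_ker, hL, Fintype.linearCombination_apply] at hg
    -- the relation as an element of `I3`
    have hE0 : C (g 0) * 1 + C (g 1) * x + C (g 2) * y + C (g 3) * x ^ 2 + C (g 4) * (x * y) +
        C (g 5) * y ^ 2 ∈ I3 := by
      rw [← Ideal.Quotient.eq_zero_iff_mem, ← hg, Fin.sum_univ_six]
      simp only [hv6, Matrix.cons_val_zero, Matrix.cons_val_one, Matrix.cons_val, map_add, mk_C_mul]
    have hE : C (g 0) * 1 + C (g 1) * x + C (g 2) * y +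
        (C (g 3) * x ^ 2 + C (g 4) * (x * y) + C (g 5) * y ^ 2) ∈ I3 := by
      have h : C (g 0) * 1 + C (g 1) * x + C (g 2) * y + (C (g 3) * x ^ 2 + C (g 4) * (x * y) + C (g 5) * y ^ 2) =
          C (g 0) * 1 + C (g 1) * x + C (g 2) * y + C (g 3) * x ^ 2 + C (g 4) * (x * y) + C (g 5) * y ^ 2 := by
        ring
      rw [h]
      exact hE0
    -- Step 1: the linear part of the relation is trivial
    have hquad_sq : C (g 3) * x ^ 2 + C (g 4) * (x * y) + C (g 5) * y ^ 2 ∈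
        maximalIdeal (MvPowerSeries (Fin n) κ) ^ 2 := by
      rw [pow_two (maximalIdeal _), pow_two, pow_two]
      exact Ideal.add_mem _ (Ideal.add_mem _ (Ideal.mul_mem_left _ _ (Ideal.mul_mem_mul hxm hxm))
        (Ideal.mul_mem_left _ _ (Ideal.mul_mem_mul hxm hym))) (Ideal.mul_mem_left _ _ (Ideal.mul_mem_mul hym hym))
    have hI3le : I3 ≤ J ⊔ maximalIdeal (MvPowerSeries (Fin n) κ) ^ 2 :=
      sup_le_sup_left (Ideal.pow_le_pow_right (by norm_num)) _
    have hlin : C (g 0) + C (g 1) * x + C (g 2) * y ∈ J ⊔ maximalIdeal (MvPowerSeries (Fin n) κ) ^ 2 := by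
      have h := Ideal.sub_mem _ (hI3le hE) (Ideal.mem_sup_right hquad_sq : _ ∈ J ⊔ _)
      rwa [add_sub_cancel_right, mul_one] at h
    obtain ⟨hg0, hg1, hg2⟩ := coeffs_eq_zero_of_linear_mem h3 hgen hlin
    -- Step 2: the quadratic relation `q ∈ (∂f) + 𝔪³` is a kernel directional derivative
    have hqI : C (g 3) * x ^ 2 + C (g 4) * (x * y) + C (g 5) * y ^ 2 ∈ I3 := by
      have h := hE
      rwa [hg0, hg1, hg2, map_zero, zero_mul, zero_mul, zero_mul, zero_add, zero_add, zero_add] at h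
    obtain ⟨j, hj, m3, hm3, hjm⟩ := Submodule.mem_sup.mp hqI
    have hj2 : j ∈ maximalIdeal (MvPowerSeries (Fin n) κ) ^ 2 := by
      have h : j = (C (g 3) * x ^ 2 + C (g 4) * (x * y) + C (g 5) * y ^ 2) - m3 := by rw [← hjm]; ring
      rw [h]
      exact Ideal.sub_mem _ hquad_sq (Ideal.pow_le_pow_right (by norm_num) hm3)
    obtain ⟨lam, r, hlam, hrmem, hjdec⟩ := exists_kernel_decomp_of_mem_jac_of_mem_sq hord hj hj2
    -- `λ = αλ₀ + βμ`, so its polar is `β·q` on the kernel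
    obtain ⟨α, β, hαβ⟩ := kernel_span_pair hM he hlam₀0 hlam₀ hμ hnot lam hlam
    have hpol : ∀ v : Fin n → κ, Matrix.vecMul v (polarMatrix f) = 0 →
        ∑ s, lam s * degForm 2 (MvPowerSeries.pderiv s f) v = β * q v := by
      intro v hv
      rw [← hαβ, polar_add_smul, hnull v hv, mul_zero, zero_add]
    -- evaluation at kernel vectors: `g₃ X² + g₄ XY + g₅ Y² = β·q` on the kernel
    have heval : ∀ v : Fin n → κ, Matrix.vecMul v (polarMatrix f) = 0 →
        g 3 * degForm 1 x v ^ 2 + g 4 * (degForm 1 x v * degForm 1 y v) + g 5 * degForm 1 y v ^ 2 = β * q v := by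
      intro v hv
      have hv' : ∀ s, degForm 1 (MvPowerSeries.pderiv s f) v = 0 := fun s => by
        rw [degForm_one_pderiv_eq_vecMul, hv, Pi.zero_apply]
      have h1 : degForm 2 (C (g 3) * x ^ 2 + C (g 4) * (x * y) + C (g 5) * y ^ 2) v =
          g 3 * degForm 1 x v ^ 2 + g 4 * (degForm 1 x v * degForm 1 y v) + g 5 * degForm 1 y v ^ 2 := by
        rw [degForm_add, degForm_add, degForm_C_mul, degForm_C_mul, degForm_C_mul, pow_two, pow_two,
          degForm_two_mul hx0 hx0, degForm_two_mul hx0 hy0, degForm_two_mul hy0 hy0]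
        ring
      have h2 : degForm 2 (C (g 3) * x ^ 2 + C (g 4) * (x * y) + C (g 5) * y ^ 2) v =
          ∑ s, lam s * degForm 2 (MvPowerSeries.pderiv s f) v := by
        rw [← hjm, degForm_add, degForm_eq_zero_of_mem_maximalIdeal_pow (by norm_num) hm3, add_zero, hjdec,
          degForm_add, degForm_two_sum_C_mul_pderiv,
          degForm_two_eq_zero_of_mem_maximalIdeal_mul_jac hf' hv' (Ideal.mem_sup_left hrmem), add_zero]
      rw [← h1, h2, hpol v hv]
    have e₁ := heval v₁ hv₁
    have e₂ := heval v₂ hv₂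
    have e₃ := heval v₃ hv₃
    rw [hx₁, hy₁] at e₁
    rw [hx₂, hy₂] at e₂
    rw [hx₃, hy₃] at e₃
    have hg3 : g 3 = β * q v₁ := by linear_combination e₁
    have hg5 : g 5 = β * q v₂ := by linear_combination e₂
    have hg4 : g 4 = β * (q v₃ - q v₁ - q v₂) := by linear_combination e₃ - e₁ - e₂
    refine Submodule.mem_span_singleton.mpr ⟨β, funext fun i => ?_⟩
    rw [Pi.smul_apply, smul_eq_mul]
    fin_cases i
    · show β * 0 = g 0
      rw [hg0, mul_zero]
    · show β * 0 = g 1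
      rw [hg1, mul_zero]
    · show β * 0 = g 2
      rw [hg2, mul_zero]
    · show β * q v₁ = g 3
      rw [hg3]
    · show β * (q v₃ - q v₁ - q v₂) = g 4
      rw [hg4]
    · show β * q v₂ = g 5
      rw [hg5]
  -- count dimensions: `dim Q₃ = 6 − dim ker L ≥ 5`
  have hk1 : Module.finrank κ (LinearMap.ker L) ≤ 1 :=
    (Submodule.finrank_mono hker).trans ((finrank_span_le_card ({u₀} : Set (Fin 6 → κ))).trans (by simp))
  have hrn := LinearMap.finrank_range_add_finrank_ker L
  rw [Module.finrank_fin_fun, hrange, finrank_top, hfr3] at hrn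
  omega

/-! ## `h₂ = 1 ⟺` no null polar -/

/-- [OURS · L1 W4.6 rung (ii) at `p = 2`, every dimension; NOT a statement of the manuscript] **`h₂ = 1`
IFF THE POLAR PENCIL OF THE KERNEL CUBIC IS INJECTIVE** (`N = 0`): for a double state of
`z² = a(u₁,…,uₙ)` (any field of characteristic `2`) with `e(c) = 2`, `h₂(c) = 1` if and only if the only
kernel vector `λ` whose polar `v ↦ Σₛ λₛ (∂ₛa)₂(v)` vanishes on the whole kernel is `λ = 0`. In the
binary normal form this is `rank [[α, γ], [β, δ]] = 2`: the tangent cubic on the kernel line has THREE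
DISTINCT roots over the algebraic closure — the `D₄` class of gen 4 (p517564: isolated with `μ = 4`;
every near point free). (`⇐`: p538084's dimension count; `⇒`: the previous theorem.) [folklore] -/
theorem hypersurface_milnorHilbertTwo_eq_one_iff_no_null_polar [CharP κ 2] (c : (Fin n → ℕ) → κ)
    (hM : MultP 2 n κ c) (he : milnorEmbDim 2 n κ c = 2) :
    milnorHilbertTwo 2 n κ c = 1 ↔
      ∀ lam : Fin n → κ, Matrix.vecMul lam (polarMatrix (ser 2 n κ c)) = 0 →
        (∀ v : Fin n → κ, Matrix.vecMul v (polarMatrix (ser 2 n κ c)) = 0 →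
          ∑ s, lam s * degForm 2 (MvPowerSeries.pderiv s (ser 2 n κ c)) v = 0) → lam = 0 := by
  have hr := milnorHilbertTwo_range hM he
  constructor
  · intro h1 lam hlam hnull
    by_contra hne
    have h2 := hypersurface_two_le_milnorHilbertTwo_of_null_polar c hM he hne hlam hnull
    omega
  · intro hN
    have h4 := jetThreeColength_le_four_of_polar_injective hM he hN
    omega

/-- [OURS · L1 W4.6 rung (ii) at `p = 2`, every dimension; NOT a statement of the manuscript] **`h₂ ≥ 2`
IFF A NON-ZERO NULL POLAR EXISTS** (`N ≠ 0`; corank two, any field of characteristic `2`): the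
multiple-tangent and no-tangent classes together are exactly the states whose kernel cubic has a
kernel direction with identically vanishing polar. [folklore] -/
theorem hypersurface_two_le_milnorHilbertTwo_iff_null_polar [CharP κ 2] (c : (Fin n → ℕ) → κ)
    (hM : MultP 2 n κ c) (he : milnorEmbDim 2 n κ c = 2) :
    2 ≤ milnorHilbertTwo 2 n κ c ↔
      ∃ lam : Fin n → κ, lam ≠ 0 ∧ Matrix.vecMul lam (polarMatrix (ser 2 n κ c)) = 0 ∧
        ∀ v : Fin n → κ, Matrix.vecMul v (polarMatrix (ser 2 n κ c)) = 0 →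
          ∑ s, lam s * degForm 2 (MvPowerSeries.pderiv s (ser 2 n κ c)) v = 0 :=
  ⟨hypersurface_exists_null_polar_of_two_le_milnorHilbertTwo c hM he,
    fun ⟨_, hne, hlam, hnull⟩ => hypersurface_two_le_milnorHilbertTwo_of_null_polar c hM he hne hlam hnull⟩

/-! ## Two independent null polars force `h₂ = 3`; at `h₂ ≤ 2` the null polars form at most a line -/

/-- [OURS · L1 W4.6 rung (ii) at `p = 2`, every dimension; NOT a statement of the manuscript] **TWO
NON-PROPORTIONAL NULL POLARS FORCE `h₂ = 3`**: if the kernel plane contains two non-proportional vectors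
`λ₁, λ₂` with identically vanishing polars, then (linearity in `λ`, the two span the kernel) ALL polars
vanish on the kernel, and `h₂ = 3` by p531822 — the «no tangent cubic» class. [folklore] -/
theorem hypersurface_two_null_polars_milnorHilbertTwo_eq_three [CharP κ 2] (c : (Fin n → ℕ) → κ)
    (hM : MultP 2 n κ c) (he : milnorEmbDim 2 n κ c = 2) {lam₁ lam₂ : Fin n → κ} (hlam₁0 : lam₁ ≠ 0)
    (hlam₁ : Matrix.vecMul lam₁ (polarMatrix (ser 2 n κ c)) = 0)
    (hlam₂ : Matrix.vecMul lam₂ (polarMatrix (ser 2 n κ c)) = 0) (hnot : ∀ r : κ, lam₂ ≠ r • lam₁)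
    (hnull₁ : ∀ v : Fin n → κ, Matrix.vecMul v (polarMatrix (ser 2 n κ c)) = 0 →
      ∑ s, lam₁ s * degForm 2 (MvPowerSeries.pderiv s (ser 2 n κ c)) v = 0)
    (hnull₂ : ∀ v : Fin n → κ, Matrix.vecMul v (polarMatrix (ser 2 n κ c)) = 0 →
      ∑ s, lam₂ s * degForm 2 (MvPowerSeries.pderiv s (ser 2 n κ c)) v = 0) :
    milnorHilbertTwo 2 n κ c = 3 := by
  refine hypersurface_milnorHilbertTwo_eq_three_of_polar_eq_zero c hM he fun lam v hlam hv => ?_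
  obtain ⟨α, β, hαβ⟩ := kernel_span_pair hM he hlam₁0 hlam₁ hlam₂ hnot lam hlam
  rw [← hαβ, polar_add_smul, hnull₁ v hv, hnull₂ v hv, mul_zero, mul_zero, add_zero]

/-- [OURS · L1 W4.6 rung (ii) at `p = 2`, every dimension; NOT a statement of the manuscript] **AT
`h₂ ≤ 2` THE NULL POLARS ARE PAIRWISE PROPORTIONAL** (`dim N ≤ 1`): contrapositive of the previous
theorem. [folklore] -/
theorem hypersurface_null_polar_unique [CharP κ 2] (c : (Fin n → ℕ) → κ) (hM : MultP 2 n κ c)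
    (he : milnorEmbDim 2 n κ c = 2) (hh : milnorHilbertTwo 2 n κ c ≤ 2) {lam₁ lam₂ : Fin n → κ}
    (hlam₁0 : lam₁ ≠ 0) (hlam₁ : Matrix.vecMul lam₁ (polarMatrix (ser 2 n κ c)) = 0)
    (hlam₂ : Matrix.vecMul lam₂ (polarMatrix (ser 2 n κ c)) = 0)
    (hnull₁ : ∀ v : Fin n → κ, Matrix.vecMul v (polarMatrix (ser 2 n κ c)) = 0 →
      ∑ s, lam₁ s * degForm 2 (MvPowerSeries.pderiv s (ser 2 n κ c)) v = 0)
    (hnull₂ : ∀ v : Fin n → κ, Matrix.vecMul v (polarMatrix (ser 2 n κ c)) = 0 →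
      ∑ s, lam₂ s * degForm 2 (MvPowerSeries.pderiv s (ser 2 n κ c)) v = 0) :
    ∃ r : κ, lam₂ = r • lam₁ := by
  by_contra h
  push Not at h
  have h3 := hypersurface_two_null_polars_milnorHilbertTwo_eq_three c hM he hlam₁0 hlam₁ hlam₂ h hnull₁ hnull₂
  omega

/-- [OURS · L1 W4.6 rung (ii) at `p = 2`, every dimension; NOT a statement of the manuscript] **`h₂ = 2`
IFF THE NULL POLARS FORM A LINE** — for a double state of `z² = a(u₁,…,uₙ)` (any field of
characteristic `2`) with `e(c) = 2`: `h₂(c) = 2` if and only if a NON-ZERO null polar exists AND some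
polar value `Σₛ λₛ (∂ₛa)₂(v)` (`λ, v ∈ ker P`) is non-zero (not every kernel vector is a null polar).
Together with `h₂ = 1 ⟺ N = 0` (above) and `h₂ = 3 ⟺ N = ker P` (p531822): **`h₂ = 1 + dim N`**, the
Hilbert function of the Milnor algebra at degree two is one plus the nullity of the polar pencil of the
tangent cubic on the kernel plane — the multiple-tangent class `(e, h₂) = (2, 2)` is `rank = 1`, a
cubic `ℓ₁²ℓ₂` or `ℓ₁³` on the kernel line over the algebraic closure. [folklore] -/
theorem hypersurface_milnorHilbertTwo_eq_two_iff_null_polar_line [CharP κ 2] (c : (Fin n → ℕ) → κ)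
    (hM : MultP 2 n κ c) (he : milnorEmbDim 2 n κ c = 2) :
    milnorHilbertTwo 2 n κ c = 2 ↔
      (∃ lam : Fin n → κ, lam ≠ 0 ∧ Matrix.vecMul lam (polarMatrix (ser 2 n κ c)) = 0 ∧
        ∀ v : Fin n → κ, Matrix.vecMul v (polarMatrix (ser 2 n κ c)) = 0 →
          ∑ s, lam s * degForm 2 (MvPowerSeries.pderiv s (ser 2 n κ c)) v = 0) ∧
      ∃ lam v : Fin n → κ, Matrix.vecMul lam (polarMatrix (ser 2 n κ c)) = 0 ∧
        Matrix.vecMul v (polarMatrix (ser 2 n κ c)) = 0 ∧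
          ∑ s, lam s * degForm 2 (MvPowerSeries.pderiv s (ser 2 n κ c)) v ≠ 0 := by
  have h2 := hypersurface_two_le_milnorHilbertTwo_iff_null_polar c hM he
  have hle := hypersurface_milnorHilbertTwo_le_two_iff_polar c hM he
  constructor
  · intro h
    exact ⟨h2.mp (by omega), hle.mp (by omega)⟩
  · rintro ⟨hN, hP⟩
    have a := h2.mpr hN
    have b := hle.mpr hP
    omega

end CampaignW46.HypersurfacesCharTwo

end Summit.ResolutionOfSingularities.ResolutionOfSingularities.Theorems

end
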